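import Literature.LinearAlgebra.QuadraticForm.PositiveProjections
import HarnessLib

/-!
# The maximal positive subspaces of a real symmetric form are path connected

Topic `LinearAlgebra/QuadraticForm`, continuation of `QuadraticForm/PositiveProjections`. For a
symmetric bilinear form `S` on a finite-dimensional real normed space `V`, the set of positive
projections (`IsPosProjection S P`: `S`-self-adjoint idempotents with positive definite range and
negative definite kernel, i.e. maximal positive definite subspaces `W` together with `W^⊥`) is PATH
CONNECTED in `V →L[ℝ] V`, and so is, for any set `C` of operators, the subset of those commuting with
`C` (`joinedIn`, `isPathConnected_setOf`, `isPreconnected_setOf`). With `C = {i}` a complex structure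
making `S` Hermitian this is the connectedness of `U(p, q)/U(p) × U(q)`, i.e. of the period domain
`X⁺` of [Deligne1982HodgeCycles, proof of Thm. 4.8, p. 49] ("an open connected complex submanifold of
a product of Grassmannians"), used there for the connectedness of the base `Γ\X⁺` of the universal
family and for reaching every member of the family; see
`QuadraticForm/PosComplexStructuresConnected` for that dictionary.

## The proof (graphs of contractions, made basis-free)

Given positive projections `P₀`, `P₁` with ranges `W₀`, `W₁`: `W₁ ∩ ker P₀ = 0`, so `W₁` is the graph
of a map `T : W₀ → ker P₀` and `W_t = {P₀ w + t (w - P₀ w) | w ∈ W₁} = B_t W₁`, `B_t = P₀ + t (1 - P₀)`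
(`stretch`), is positive definite for `t ∈ [0, 1]`
(`S (B_t z) (B_t z) = S (P₀ z) (P₀ z) + t² S (z - P₀ z) (z - P₀ z) ≥ S z z`, `apply_stretch_self`,
`le_apply_stretch_self`) of the same dimension, hence maximal. The `S`-orthogonal projection onto `W_t`
is written without choosing `T` or a basis as
`P_t = A_t G_t⁻¹ A_t†`, `A_t = B_t P₁`, `A_t† = P₁ B_t`, `G_t = P₁ B_{t²} P₁ + (1 - P₁)`
(`graphMap`, `graphMapAdj`, `gramOp`, `projPath`, defined in the companion file), where `G_t` is
injective (`S (G_t x) x ≥ S (P₁ x) (P₁ x)`), hence a unit of the Banach algebra `V →L[ℝ] V`;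
`P_t v ∈ W_t` and
`v - P_t v ⊥ W_t` (`ortho_projPath`), so `P_t` is a positive projection by the characterisation of the
companion file, `P_0 = P₀`, `P_1 = P₁` by uniqueness, `t ↦ P_t` is continuous because `Ring.inverse`
is continuous at units (`NormedRing.inverse_continuousAt`), and `P_t` commutes with every operator
commuting with `P₀` and `P₁` because it is a formula in them. This is the classical convexity of the
bounded realisation `{Z | 1 - Z* Z > 0}` of this symmetric space (S. Helgason, Differential Geometry,
Lie Groups, and Symmetric Spaces, 1978, Ch. VIII §7; I. Satake, Algebraic Structures of Symmetric
Domains, 1980, Ch. II), with the straight segment `t Z`.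

Everything is proved, Mathlib only; no named facts.

## References

* [Deligne1982HodgeCycles] P. Deligne (notes by J. S. Milne), Hodge cycles on abelian varieties,
  LNM 900 (1982), proof of Thm. 4.8, p. 49.
* S. Helgason, Differential Geometry, Lie Groups, and Symmetric Spaces, Academic Press 1978,
  Ch. VIII §7 (bounded symmetric domains), Ch. X Table V.
* I. Satake, Algebraic Structures of Symmetric Domains, Iwanami Shoten / Princeton UP 1980, Ch. II.
  Standard; the statements below are tagged folklore.
-/

noncomputable section

namespace Literature.LinearAlgebra.QuadraticForm

open Module Set

variable {V : Type*} [NormedAddCommGroup V] [NormedSpace ℝ V]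

namespace IsPosProjection

variable {S : LinearMap.BilinForm ℝ V} {P₀ P₁ : V →L[ℝ] V}

/-! ### The stretch `B_t = P₀ + t (1 - P₀)` -/

/-- `B_s B_t = B_{st}`. [folklore] -/
theorem stretch_stretch (hP₀ : IsPosProjection S P₀) (s t : ℝ) (x : V) :
    stretch P₀ s (stretch P₀ t x) = stretch P₀ (s * t) x := by
  simp only [stretch_apply, map_add, map_smul, map_sub, hP₀.apply_apply]
  module

/-- `P₀ B_t = P₀`. [folklore] -/
theorem apply_stretch (hP₀ : IsPosProjection S P₀) (t : ℝ) (x : V) :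
    P₀ (stretch P₀ t x) = P₀ x := by
  simp only [stretch_apply, map_add, map_smul, map_sub, hP₀.apply_apply, sub_self, smul_zero,
    add_zero]

/-- `(1 - P₀) B_t = t (1 - P₀)`. [folklore] -/
theorem stretch_sub_apply (hP₀ : IsPosProjection S P₀) (t : ℝ) (x : V) :
    stretch P₀ t x - P₀ (stretch P₀ t x) = t • (x - P₀ x) := by
  rw [hP₀.apply_stretch, stretch_apply, add_sub_cancel_left]

/-- `B_t` is `S`-self-adjoint. [folklore] -/
theorem stretch_selfAdjoint (hP₀ : IsPosProjection S P₀) (t : ℝ) (x y : V) :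
    S (stretch P₀ t x) y = S x (stretch P₀ t y) := by
  simp only [stretch_apply, map_add, map_smul, map_sub, LinearMap.add_apply, LinearMap.smul_apply,
    LinearMap.sub_apply, hP₀.selfAdjoint]

/-- Pythagoras along the stretch:
`S (B_t z) (B_t z) = S (P₀ z) (P₀ z) + t² S (z - P₀ z) (z - P₀ z)`. [folklore] -/
theorem apply_stretch_self (hP₀ : IsPosProjection S P₀) (hS : S.IsSymm) (t : ℝ) (z : V) :
    S (stretch P₀ t z) (stretch P₀ t z) =
      S (P₀ z) (P₀ z) + t ^ 2 * S (z - P₀ z) (z - P₀ z) := by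
  rw [hP₀.self_eq hS (stretch P₀ t z), hP₀.stretch_sub_apply, hP₀.apply_stretch]
  simp only [map_smul, LinearMap.smul_apply, smul_eq_mul]
  ring

/-- For `t ∈ [0, 1]` the stretch does not decrease `S z z` (the kernel of `P₀` is negative
definite): the graph of `t T` is positive definite when the graph of `T` is. [folklore] -/
theorem le_apply_stretch_self (hP₀ : IsPosProjection S P₀) (hS : S.IsSymm) {t : ℝ}
    (ht : t ∈ unitInterval) (z : V) : S z z ≤ S (stretch P₀ t z) (stretch P₀ t z) := by
  rw [hP₀.apply_stretch_self hS, hP₀.self_eq hS z]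
  have h1 : S (z - P₀ z) (z - P₀ z) ≤ 0 := hP₀.sub_apply_nonpos z
  obtain ⟨ht0, ht1⟩ := ht
  have ht2 : t ^ 2 ≤ 1 := by nlinarith
  nlinarith [mul_nonneg (sub_nonneg.2 ht2) (neg_nonneg.2 h1)]

/-- `B_t` is injective on `range P₁` for `t ∈ [0, 1]`. [folklore] -/
theorem apply_eq_zero_of_stretch (hP₀ : IsPosProjection S P₀) (hP₁ : IsPosProjection S P₁)
    (hS : S.IsSymm) {t : ℝ} (ht : t ∈ unitInterval) {w : V} (h : stretch P₀ t (P₁ w) = 0) :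
    P₁ w = 0 := by
  by_contra hne
  have h1 := hP₁.pos_apply hne
  have h2 := hP₀.le_apply_stretch_self hS ht (P₁ w)
  simp only [h, map_zero] at h2
  exact absurd h1 (not_lt.2 h2)

/-! ### The projection onto the graph of `t T` -/

/-- `S (A_t x) y = S x (A_t† y)`. [folklore] -/
theorem graphMap_selfAdjoint (hP₀ : IsPosProjection S P₀) (hP₁ : IsPosProjection S P₁) (t : ℝ)
    (x y : V) : S (graphMap P₀ P₁ t x) y = S x (graphMapAdj P₀ P₁ t y) := by
  rw [graphMap_apply, hP₀.stretch_selfAdjoint, hP₁.selfAdjoint, graphMapAdj_apply]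

/-- `A_t† A_t = P₁ B_{t²} P₁`. [folklore] -/
theorem graphMapAdj_graphMap (hP₀ : IsPosProjection S P₀) (t : ℝ) (x : V) :
    graphMapAdj P₀ P₁ t (graphMap P₀ P₁ t x) = P₁ (stretch P₀ (t ^ 2) (P₁ x)) := by
  rw [graphMapAdj_apply, graphMap_apply, hP₀.stretch_stretch, sq]

/-- Components along `range P₁ ⊕ ker P₁` are unique. [folklore] -/
theorem eq_of_add_eq (P₁ : V →L[ℝ] V) {a b c : V} (h : a + b = c) (ha : P₁ a = a)
    (hb : P₁ b = 0) (hc : P₁ c = c) : a = c ∧ b = 0 := by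
  have h1 : a = c := by
    have h' := congrArg P₁ h
    rwa [map_add, ha, hb, add_zero, hc] at h'
  refine ⟨h1, ?_⟩
  rw [h1] at h
  simpa using h

/-- The Gram operator is injective for `t ∈ [0, 1]`: `G_t x = 0` forces `x ∈ range P₁` and
`0 = S (G_t x) x = S (B_t P₁ x) (B_t P₁ x) ≥ S (P₁ x) (P₁ x)`. [folklore] -/
theorem gramOp_injective (hP₀ : IsPosProjection S P₀) (hP₁ : IsPosProjection S P₁) (hS : S.IsSymm)
    {t : ℝ} (ht : t ∈ unitInterval) : Function.Injective (gramOp P₀ P₁ t) := by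
  refine (injective_iff_map_eq_zero _).2 fun x hx => ?_
  rw [gramOp_apply] at hx
  obtain ⟨h1, h2⟩ := eq_of_add_eq P₁ hx (hP₁.apply_apply _) (hP₁.apply_sub x) (map_zero P₁)
  have h3 : S (stretch P₀ t (P₁ x)) (stretch P₀ t (P₁ x)) = 0 := by
    have h' : S (P₁ (stretch P₀ (t ^ 2) (P₁ x))) x = 0 := by
      rw [h1, map_zero, LinearMap.zero_apply]
    rwa [hP₁.selfAdjoint, sq, ← hP₀.stretch_stretch, hP₀.stretch_selfAdjoint] at h'
  have h4 : P₁ x = 0 := by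
    by_contra hne
    have hle := hP₀.le_apply_stretch_self hS ht (P₁ x)
    rw [h3] at hle
    exact absurd (hP₁.pos_apply hne) (not_lt.2 hle)
  rwa [h4, sub_zero] at h2

/-- `A_t† A_t G_t⁻¹ A_t† = A_t†`: on `range P₁` the Gram operator is `A_t† A_t`. [folklore] -/
theorem graphMapAdj_graphMap_inverse (hP₁ : IsPosProjection S P₁) {t : ℝ}
    (hunit : IsUnit (gramOp P₀ P₁ t)) (v : V) :
    P₁ (stretch P₀ (t ^ 2) (P₁ (Ring.inverse (gramOp P₀ P₁ t) (graphMapAdj P₀ P₁ t v)))) =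
      graphMapAdj P₀ P₁ t v := by
  have hG : gramOp P₀ P₁ t (Ring.inverse (gramOp P₀ P₁ t) (graphMapAdj P₀ P₁ t v)) =
      graphMapAdj P₀ P₁ t v :=
    DFunLike.congr_fun (Ring.mul_inverse_cancel _ hunit) (graphMapAdj P₀ P₁ t v)
  rw [gramOp_apply] at hG
  exact (eq_of_add_eq P₁ hG (hP₁.apply_apply _) (hP₁.apply_sub _) (hP₁.apply_apply _)).1

/-- **`v - P_t v` is `S`-orthogonal to `W_t = range A_t`.** [folklore] -/
theorem ortho_projPath (hP₀ : IsPosProjection S P₀) (hP₁ : IsPosProjection S P₁) {t : ℝ}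
    (hunit : IsUnit (gramOp P₀ P₁ t)) (w v : V) :
    S (graphMap P₀ P₁ t w) (v - projPath P₀ P₁ t v) = 0 := by
  rw [hP₀.graphMap_selfAdjoint hP₁, map_sub, projPath_apply, hP₀.graphMapAdj_graphMap,
    hP₁.graphMapAdj_graphMap_inverse hunit, sub_self, map_zero]

/-- **`W_t = range A_t` is positive definite** for `t ∈ [0, 1]`. [folklore] -/
theorem pos_of_mem_range_graphMap (hP₀ : IsPosProjection S P₀) (hP₁ : IsPosProjection S P₁)
    (hS : S.IsSymm) {t : ℝ} (ht : t ∈ unitInterval) :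
    ∀ u ∈ LinearMap.range (graphMap P₀ P₁ t : V →ₗ[ℝ] V), u ≠ 0 → 0 < S u u := by
  rintro _ ⟨w, rfl⟩ hne
  have hne' : P₁ w ≠ 0 := by
    intro h
    apply hne
    change stretch P₀ t (P₁ w) = 0
    rw [h, map_zero]
  calc (0 : ℝ) < S (P₁ w) (P₁ w) := hP₁.pos_apply hne'
    _ ≤ _ := hP₀.le_apply_stretch_self hS ht (P₁ w)

/-- `dim W_t = dim range P₁` (`B_t` is injective on `range P₁`). [folklore] -/
theorem finrank_range_graphMap (hP₀ : IsPosProjection S P₀) (hP₁ : IsPosProjection S P₁)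
    (hS : S.IsSymm) {t : ℝ} (ht : t ∈ unitInterval) :
    finrank ℝ (LinearMap.range (graphMap P₀ P₁ t : V →ₗ[ℝ] V)) =
      finrank ℝ (LinearMap.range (P₁ : V →ₗ[ℝ] V)) := by
  have hcomp : (graphMap P₀ P₁ t : V →ₗ[ℝ] V) =
      (stretch P₀ t : V →ₗ[ℝ] V).comp (P₁ : V →ₗ[ℝ] V) := rfl
  rw [hcomp, LinearMap.range_comp]
  have hinj : Function.Injective
      ((stretch P₀ t : V →ₗ[ℝ] V).domRestrict (LinearMap.range (P₁ : V →ₗ[ℝ] V))) := by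
    refine (injective_iff_map_eq_zero _).2 ?_
    rintro ⟨_, ⟨w, rfl⟩⟩ h
    have h' : stretch P₀ t (P₁ w) = 0 := h
    have h0 := hP₀.apply_eq_zero_of_stretch hP₁ hS ht h'
    ext
    change (P₁ : V →ₗ[ℝ] V) w = 0
    exact h0
  have hfin := LinearMap.finrank_range_of_inj hinj
  rwa [LinearMap.range_domRestrict] at hfin

section FiniteDimensional

variable [FiniteDimensional ℝ V]

/-- The Gram operator is a unit of `V →L[ℝ] V` for `t ∈ [0, 1]`. [folklore] -/
theorem isUnit_gramOp (hP₀ : IsPosProjection S P₀) (hP₁ : IsPosProjection S P₁) (hS : S.IsSymm)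
    {t : ℝ} (ht : t ∈ unitInterval) : IsUnit (gramOp P₀ P₁ t) := by
  rw [ContinuousLinearMap.isUnit_iff_bijective]
  exact ⟨gramOp_injective hP₀ hP₁ hS ht,
    LinearMap.injective_iff_surjective.1 (gramOp_injective hP₀ hP₁ hS ht)⟩

/-- **`P_t` is a positive projection** for `t ∈ [0, 1]` (characterisation by range `W_t`, which is
positive definite of the right dimension, and `v - P_t v ⊥ W_t`). [folklore] -/
theorem isPosProjection_projPath (hP₀ : IsPosProjection S P₀) (hP₁ : IsPosProjection S P₁)
    (hS : S.IsSymm) {t : ℝ} (ht : t ∈ unitInterval) : IsPosProjection S (projPath P₀ P₁ t) := by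
  have hunit := isUnit_gramOp hP₀ hP₁ hS ht
  refine hP₀.of_range hS (U := LinearMap.range (graphMap P₀ P₁ t : V →ₗ[ℝ] V))
    (pos_of_mem_range_graphMap hP₀ hP₁ hS ht) ?_ (fun v => ⟨_, rfl⟩) ?_
  · rw [finrank_range_graphMap hP₀ hP₁ hS ht, hP₀.finrank_range_eq hP₁]
  · rintro v _ ⟨w, rfl⟩
    exact hP₀.ortho_projPath hP₁ hunit w v

/-- `P_1 = P₁`. [folklore] -/
theorem projPath_one (hP₀ : IsPosProjection S P₀) (hP₁ : IsPosProjection S P₁) (hS : S.IsSymm) :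
    projPath P₀ P₁ 1 = P₁ := by
  have hunit := isUnit_gramOp hP₀ hP₁ hS (t := 1) ⟨zero_le_one, le_rfl⟩
  have hA : graphMap P₀ P₁ 1 = P₁ := by simp [graphMap, stretch_one]
  refine eq_of_range (U := LinearMap.range (P₁ : V →ₗ[ℝ] V)) hP₁.pos_of_mem_range
    (fun v => ?_) (fun v u hu => ?_) (fun v => ⟨v, rfl⟩) hP₁.ortho_of_mem_range
  · rw [projPath_apply, hA]
    exact ⟨_, rfl⟩
  · obtain ⟨w, rfl⟩ := hu
    have h := hP₀.ortho_projPath hP₁ hunit w v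
    rwa [hA] at h

/-- `P_0 = P₀` (the range of `A_0 = P₀ P₁` is all of `range P₀` by the dimension count).
[folklore] -/
theorem projPath_zero (hP₀ : IsPosProjection S P₀) (hP₁ : IsPosProjection S P₁) (hS : S.IsSymm) :
    projPath P₀ P₁ 0 = P₀ := by
  have ht : (0 : ℝ) ∈ unitInterval := ⟨le_rfl, zero_le_one⟩
  have hunit := isUnit_gramOp hP₀ hP₁ hS ht
  have hA : graphMap P₀ P₁ 0 = P₀ * P₁ := by simp [graphMap, stretch_zero]
  have hU : LinearMap.range (graphMap P₀ P₁ 0 : V →ₗ[ℝ] V) = LinearMap.range (P₀ : V →ₗ[ℝ] V) := by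
    apply Submodule.eq_of_le_of_finrank_eq
    · rw [hA]
      exact LinearMap.range_comp_le_range (P₁ : V →ₗ[ℝ] V) (P₀ : V →ₗ[ℝ] V)
    · rw [finrank_range_graphMap hP₀ hP₁ hS ht, hP₀.finrank_range_eq hP₁]
  refine eq_of_range (U := LinearMap.range (P₀ : V →ₗ[ℝ] V)) hP₀.pos_of_mem_range
    (fun v => ?_) (fun v u hu => ?_) (fun v => ⟨v, rfl⟩) hP₀.ortho_of_mem_range
  · rw [← hU]
    exact ⟨_, rfl⟩
  · rw [← hU] at hu
    obtain ⟨w, rfl⟩ := hu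
    exact hP₀.ortho_projPath hP₁ hunit w v

/-- `t ↦ P_t` is continuous at every `t ∈ [0, 1]` (`Ring.inverse` is continuous at units of the
Banach algebra `V →L[ℝ] V`). [folklore] -/
theorem continuousAt_projPath (hP₀ : IsPosProjection S P₀) (hP₁ : IsPosProjection S P₁)
    (hS : S.IsSymm) {t : ℝ} (ht : t ∈ unitInterval) : ContinuousAt (projPath P₀ P₁) t := by
  have hunit := isUnit_gramOp hP₀ hP₁ hS ht
  have hB : Continuous (stretch P₀) := by unfold stretch; fun_prop
  have hA : Continuous (graphMap P₀ P₁) := by unfold graphMap; fun_prop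
  have hA' : Continuous (graphMapAdj P₀ P₁) := by unfold graphMapAdj; fun_prop
  have hG : Continuous (gramOp P₀ P₁) := by unfold gramOp; fun_prop
  have hinv : ContinuousAt (fun s => Ring.inverse (gramOp P₀ P₁ s)) t := by
    have h1 : ContinuousAt Ring.inverse (gramOp P₀ P₁ t) := by
      have h := NormedRing.inverse_continuousAt hunit.unit
      rwa [hunit.unit_spec] at h
    exact h1.comp hG.continuousAt
  change ContinuousAt
    (fun s => graphMap P₀ P₁ s * Ring.inverse (gramOp P₀ P₁ s) * graphMapAdj P₀ P₁ s) t
  exact (hA.continuousAt.mul hinv).mul hA'.continuousAt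

end FiniteDimensional

/-- `Ring.inverse` preserves commutation. [folklore] -/
theorem commute_ringInverse {R : Type*} [MonoidWithZero R] {c g : R} (h : Commute c g) :
    Commute c (Ring.inverse g) := by
  by_cases hg : IsUnit g
  · obtain ⟨u, rfl⟩ := hg
    rw [Ring.inverse_unit]
    exact h.units_inv_right
  · rw [Ring.inverse_non_unit _ hg]
    exact Commute.zero_right c

/-- **Equivariance.** An operator commuting with `P₀` and `P₁` commutes with every `P_t` (which is a
formula in `P₀`, `P₁`). [folklore] -/
theorem commute_projPath {c : V →L[ℝ] V} (h₀ : Commute c P₀) (h₁ : Commute c P₁) (t : ℝ) :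
    Commute c (projPath P₀ P₁ t) := by
  have hB : ∀ s : ℝ, Commute c (stretch P₀ s) := fun s =>
    h₀.add_right (((Commute.one_right c).sub_right h₀).smul_right s)
  have hA : Commute c (graphMap P₀ P₁ t) := (hB t).mul_right h₁
  have hA' : Commute c (graphMapAdj P₀ P₁ t) := h₁.mul_right (hB t)
  have hG : Commute c (gramOp P₀ P₁ t) :=
    ((h₁.mul_right (hB _)).mul_right h₁).add_right ((Commute.one_right c).sub_right h₁)
  exact (hA.mul_right (commute_ringInverse hG)).mul_right hA'

section Main

variable [FiniteDimensional ℝ V]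

/-- **The positive projections of a symmetric form commuting with a given set of operators are
pairwise joined by paths of such** (graph path `P_t`, `t ∈ [0, 1]`). With `C = ∅`: the symmetric
space `O(p, q)/O(p) × O(q)` of maximal positive subspaces is path connected; with `C = {i}`, `i` a
compatible complex structure: `U(p, q)/U(p) × U(q)` is ([Deligne1982HodgeCycles, p. 49]: "`X⁺` is …
connected"). [folklore] -/
theorem joinedIn (hS : S.IsSymm) (hP₀ : IsPosProjection S P₀) (hP₁ : IsPosProjection S P₁)
    (C : Set (V →L[ℝ] V)) (hC₀ : ∀ c ∈ C, Commute c P₀) (hC₁ : ∀ c ∈ C, Commute c P₁) :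
    JoinedIn {P | IsPosProjection S P ∧ ∀ c ∈ C, Commute c P} P₀ P₁ := by
  refine JoinedIn.ofLine (f := projPath P₀ P₁) (fun t ht => ?_) (projPath_zero hP₀ hP₁ hS)
    (projPath_one hP₀ hP₁ hS) ?_
  · exact (continuousAt_projPath hP₀ hP₁ hS ht).continuousWithinAt
  · rintro _ ⟨t, ht, rfl⟩
    exact ⟨isPosProjection_projPath hP₀ hP₁ hS ht, fun c hc => commute_projPath (hC₀ c hc) (hC₁ c hc) t⟩

/-- **Path connectedness** of the positive projections commuting with `C`, when there is one.
[folklore] -/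
theorem isPathConnected_setOf (hS : S.IsSymm) (C : Set (V →L[ℝ] V))
    (hne : {P | IsPosProjection S P ∧ ∀ c ∈ C, Commute c P}.Nonempty) :
    IsPathConnected {P | IsPosProjection S P ∧ ∀ c ∈ C, Commute c P} :=
  isPathConnected_iff.2 ⟨hne, fun _ hP _ hQ => joinedIn hS hP.1 hQ.1 C hP.2 hQ.2⟩

/-- The positive projections commuting with `C` form a preconnected (empty or connected) set.
[folklore] -/
theorem isPreconnected_setOf (hS : S.IsSymm) (C : Set (V →L[ℝ] V)) :
    IsPreconnected {P | IsPosProjection S P ∧ ∀ c ∈ C, Commute c P} := by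
  rcases Set.eq_empty_or_nonempty {P | IsPosProjection S P ∧ ∀ c ∈ C, Commute c P} with h | hne
  · rw [h]
    exact isPreconnected_empty
  · exact (isPathConnected_setOf hS C hne).isConnected.isPreconnected

end Main

end IsPosProjection

end Literature.LinearAlgebra.QuadraticForm
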